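import Literature.Geometry.Riemannian.BakryEmeryHeatFlow
import HarnessLib

/-!
# The integrated `Γ₂`-inequality of Bakry–Émery on a closed weighted manifold:
# `∫ (Lu)² dm ≥ K ∫ |∇u|² dm` under `Ric + Hess V ≥ K g`

Companion of `BakryEmeryHeatFlow.lean` (towards the remaining input of
`carrilloNi_muEntropy_eq_log_shrinkerDensity_holds`, the weighted heat flow: its convergence to
equilibrium rests on the spectral gap of `L = Δ_g − g⁻¹(dV, d·)`). For a closed Riemannian
manifold (any model space), a smooth weight `V` with `Ric + Hess V ≥ K g` and `dm = e^{-V} dV_g`,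
we PROVE, for every smooth `u`:

* `contMDiff_innerDual` — `x ↦ g⁻¹(dF₁, dF₂)(x)` is smooth for smooth `F₁, F₂`;
* `weightedBochner_pointwise_ge` — **the pointwise `Γ₂ ≥ KΓ` inequality**
  `½ L|∇u|² − g⁻¹(du, d(Lu)) ≥ K |∇u|²` (the weighted Bochner formula
  `½ L|∇u|² = |Hess u|² + ⟨∇u, ∇Lu⟩ + (Ric + Hess V)(∇u, ∇u)` of
  `CoordFisherDissipation.lean`, read through the chart at the point, dropping `|Hess u|² ≥ 0`);
* `integral_sq_weightedLaplacian_ge` — **`K ∫ |∇u|² dm ≤ ∫ (Lu)² dm`** (integration: `∫ L|∇u|² dm = 0`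
  and `∫ g⁻¹(du, d(Lu)) dm = −∫ (Lu)² dm` by the weighted Green identities).

This is the "integrated `Γ₂`" form of the curvature-dimension condition `CD(K, ∞)`
(Bakry–Émery 1985; Bakry–Gentil–Ledoux 2014, §3.3 and Prop. 4.8.3: under `CD(ρ, ∞)` the
spectral gap of `−L` is at least `ρ`), which for `V = 0` is Lichnerowicz's estimate. Everything
is proved; no definitions, no named facts.

## References

* D. Bakry, M. Émery, *Diffusions hypercontractives*, LNM 1123 (1985) 177–206. [BakryEmery1985]
* D. Bakry, I. Gentil, M. Ledoux, *Analysis and geometry of Markov diffusion operators* (2014),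
  §1.16, §3.3, Prop. 4.8.3. [BakryGentilLedoux2014]
* [CarrilloNi2009] J. A. Carrillo, L. Ni, Comm. Anal. Geom. 17 (2009), §3 (the `C(K, ∞)`
  condition and the Bochner computation, p. 8).
-/

noncomputable section

open Bundle Set Function Module Filter Manifold MeasureTheory
open scoped ContDiff Topology

namespace Literature.Geometry.Riemannian

open Lorentzian Lorentzian.PseudoRiemannianMetric

section Pointwise

variable {E : Type*} [NormedAddCommGroup E] [NormedSpace ℝ E] [FiniteDimensional ℝ E]
  {H : Type*} [TopologicalSpace H] {I : ModelWithCorners ℝ E H} [I.Boundaryless]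
  {M : Type*} [TopologicalSpace M] [ChartedSpace H M] [IsManifold I ∞ M]
  (g : PseudoRiemannianMetric I ∞ E (TangentSpace I : M → Type _))

/-- **`g⁻¹(dF₁, dF₂)` is smooth for smooth `F₁, F₂`** (the constant families in
`contMDiffOn_innerDual_family`). [folklore] -/
theorem contMDiff_innerDual {F₁ F₂ : M → ℝ} (h₁ : ContMDiff I 𝓘(ℝ, ℝ) ∞ F₁)
    (h₂ : ContMDiff I 𝓘(ℝ, ℝ) ∞ F₂) :
    ContMDiff I 𝓘(ℝ, ℝ) ∞ fun y ↦ g.innerDual y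
      (mvfderiv I F₁ y : TangentSpace I y →ₗ[ℝ] ℝ) (mvfderiv I F₂ y : TangentSpace I y →ₗ[ℝ] ℝ) := by
  have hfam : ContMDiffOn (I.prod 𝓘(ℝ, ℝ)) 𝓘(ℝ, ℝ) ∞
      (fun p : M × ℝ ↦ g.innerDual p.1
        (mvfderiv I F₁ p.1 : TangentSpace I p.1 →ₗ[ℝ] ℝ)
        (mvfderiv I F₂ p.1 : TangentSpace I p.1 →ₗ[ℝ] ℝ)) (univ ×ˢ (univ : Set ℝ)) :=
    contMDiffOn_innerDual_family g (f₁ := fun _ ↦ F₁) (f₂ := fun _ ↦ F₂) uniqueDiffOn_univ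
      ((h₁.comp contMDiff_fst).contMDiffOn) ((h₂.comp contMDiff_fst).contMDiffOn)
  have hι : ContMDiff I (I.prod 𝓘(ℝ, ℝ)) ∞ (fun y : M ↦ (y, (0 : ℝ))) :=
    contMDiff_id.prodMk contMDiff_const
  exact hfam.comp_contMDiff hι fun y ↦ ⟨mem_univ _, mem_univ _⟩

variable [g.HasLeviCivita]

/-- **The pointwise `Γ₂ ≥ K Γ` inequality of a weighted manifold with `Ric + Hess V ≥ K g`**
(Bakry–Émery): for smooth `u`, `V` and every `x`,

  `K |∇u|²(x) ≤ ½ L(|∇u|²)(x) − g⁻¹(du, d(Lu))(x)`,  `L = Δ_g − g⁻¹(dV, d·)`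

— the weighted Bochner formula `½L|∇u|² = |Hess u|² + ⟨∇u, ∇Lu⟩ + (Ric + Hess V)(∇u, ∇u)`
(`MetricCoord.IsMetricOn.weightedLapAt_gradSqAt`, in the chart at `x`) with `|Hess u|² ≥ 0`.
[cite: CarrilloNi2009, §3 (C(K,∞) and the Bochner type formula, p. 8)] -/
theorem weightedBochner_pointwise_ge (hR : g.IsRiemannian) {V : M → ℝ} {K : ℝ}
    (hV : ContMDiff I 𝓘(ℝ, ℝ) ∞ V)
    (hRic : ∀ (y : M) (X : TangentSpace I y), K * g.val y X X ≤ g.ricci y X X + g.hessian V y X X)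
    {u : M → ℝ} (hu : ContMDiff I 𝓘(ℝ, ℝ) ∞ u) (x : M) :
    K * g.gradSq u x ≤
      (1 / 2) * (g.dalembertian (g.gradSq u) x
        - g.innerDual x (mvfderiv I V x : TangentSpace I x →ₗ[ℝ] ℝ)
            (mvfderiv I (g.gradSq u) x : TangentSpace I x →ₗ[ℝ] ℝ))
      - g.innerDual x (mvfderiv I u x : TangentSpace I x →ₗ[ℝ] ℝ)
          (mvfderiv I (fun y ↦ g.dalembertian u y
            - g.innerDual y (mvfderiv I V y : TangentSpace I y →ₗ[ℝ] ℝ)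
                (mvfderiv I u y : TangentSpace I y →ₗ[ℝ] ℝ)) x : TangentSpace I x →ₗ[ℝ] ℝ) := by
  -- the chart at `x`, components and representatives
  set G := chartRep I (fun _ ↦ g) x 0 with hGdef
  have hGm : MetricCoord.IsMetricOn G (extChartAt I x).target :=
    Lorentzian.OpensChart.isMetricOn_repr (val_chartPullback_eq_chartRep (fun _ : ℝ ↦ g) x 0)
  set uh : E → ℝ := u ∘ (extChartAt I x).symm with huhdef
  set Vh : E → ℝ := V ∘ (extChartAt I x).symm with hVhdef
  have hu0 : extChartAt I x x ∈ (extChartAt I x).target := mem_extChartAt_target x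
  set u₀ : chartTarget I x := ⟨extChartAt I x x, hu0⟩ with hu₀def
  have hΦu₀ : chartInv I x u₀ = x := extChartAt_to_inv x
  have huh : ContDiffOn ℝ ∞ uh (extChartAt I x).target := by
    rw [huhdef, ← contMDiffOn_iff_contDiffOn]
    exact hu.comp_contMDiffOn (contMDiffOn_extChartAt_symm x)
  have hVh : ContDiffOn ℝ ∞ Vh (extChartAt I x).target := by
    rw [hVhdef, ← contMDiffOn_iff_contDiffOn]
    exact hV.comp_contMDiffOn (contMDiffOn_extChartAt_symm x)
  -- the coordinate weighted Bochner formula at `φ x`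
  have key := hGm.weightedLapAt_gradSqAt hu0 huh hVh
  -- regularity of the manifold-level functions
  have hud : ∀ y, MDifferentiableAt I 𝓘(ℝ, ℝ) u y := fun y ↦ hu.mdifferentiableAt (by simp)
  have hVd : ∀ y, MDifferentiableAt I 𝓘(ℝ, ℝ) V y := fun y ↦ hV.mdifferentiableAt (by simp)
  have hQ : ContMDiff I 𝓘(ℝ, ℝ) ∞ (g.gradSq u) := contMDiff_gradSq g hu
  have hQd : ∀ y, MDifferentiableAt I 𝓘(ℝ, ℝ) (g.gradSq u) y := fun y ↦ hQ.mdifferentiableAt (by simp)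
  have hQ2 : ContMDiffAt I 𝓘(ℝ, ℝ) 2 (g.gradSq u) (chartInv I x u₀) :=
    (hQ.of_le (WithTop.coe_le_coe.mpr le_top)).contMDiffAt
  have hLs : ContMDiff I 𝓘(ℝ, ℝ) ∞ (fun y ↦ g.dalembertian u y
      - g.innerDual y (mvfderiv I V y : TangentSpace I y →ₗ[ℝ] ℝ)
          (mvfderiv I u y : TangentSpace I y →ₗ[ℝ] ℝ)) :=
    (contMDiff_dalembertian g hu).sub (contMDiff_innerDual g hV hu)
  have hLd : ∀ y, MDifferentiableAt I 𝓘(ℝ, ℝ) (fun y ↦ g.dalembertian u y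
      - g.innerDual y (mvfderiv I V y : TangentSpace I y →ₗ[ℝ] ℝ)
          (mvfderiv I u y : TangentSpace I y →ₗ[ℝ] ℝ)) y := fun y ↦ hLs.mdifferentiableAt (by simp)
  -- (a) `|∇u|²` read in the chart (as a function near `φ x`) and `|∇u|²(x)`
  have hQrep : (g.gradSq u ∘ (extChartAt I x).symm) =ᶠ[𝓝 (extChartAt I x x)]
      MetricCoord.gradSqAt G uh := by
    filter_upwards [(isOpen_extChartAt_target x).mem_nhds hu0] with z hz
    exact gradSq_chartInv_eq g x ⟨z, hz⟩ (hud _)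
  have hgrad : g.gradSq u x = MetricCoord.gradSqAt G uh (extChartAt I x x) := by
    have h := gradSq_chartInv_eq g x u₀ (F := u) (hud _)
    rw [hΦu₀] at h
    exact h
  -- (b) `Δ|∇u|²` and `g⁻¹(dV, d|∇u|²)`
  have hlap : g.dalembertian (g.gradSq u) x =
      MetricCoord.lapAt G (MetricCoord.gradSqAt G uh) (extChartAt I x x) := by
    have h := dalembertian_chartInv_eq g x u₀ hQ2
    rw [hΦu₀] at h
    rw [h]
    exact MetricCoord.lapAt_congr_of_eventuallyEq G hQrep
  have hIV : g.innerDual x (mvfderiv I V x : TangentSpace I x →ₗ[ℝ] ℝ)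
      (mvfderiv I (g.gradSq u) x : TangentSpace I x →ₗ[ℝ] ℝ) =
      fderiv ℝ (MetricCoord.gradSqAt G uh) (extChartAt I x x)
        (MetricCoord.sharpAt G (extChartAt I x x) (fderiv ℝ Vh (extChartAt I x x))) := by
    have h := innerDual_chartInv_eq g x u₀ (hVd _) (hQd _)
    rw [hΦu₀] at h
    rw [h, MetricCoord.apply_sharpAt_comm (hGm.isInvertible _ hu0) (hGm.symm _ hu0),
      hQrep.fderiv_eq]
  -- (c) `g⁻¹(du, d(Lu))`: the representative of `Lu` near `φ x`
  have hLrep : ((fun y ↦ g.dalembertian u y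
      - g.innerDual y (mvfderiv I V y : TangentSpace I y →ₗ[ℝ] ℝ)
          (mvfderiv I u y : TangentSpace I y →ₗ[ℝ] ℝ)) ∘ (extChartAt I x).symm) =ᶠ[𝓝 (extChartAt I x x)]
      fun z ↦ MetricCoord.lapAt G uh z
        - fderiv ℝ uh z (MetricCoord.sharpAt G z (fderiv ℝ Vh z)) := by
    filter_upwards [(isOpen_extChartAt_target x).mem_nhds hu0] with z hz
    have hu2 : ContMDiffAt I 𝓘(ℝ, ℝ) 2 u (chartInv I x ⟨z, hz⟩) :=
      (hu.of_le (WithTop.coe_le_coe.mpr le_top)).contMDiffAt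
    have h1 := dalembertian_chartInv_eq g x ⟨z, hz⟩ hu2
    have h2 := innerDual_chartInv_eq g x ⟨z, hz⟩ (hVd _) (hud _)
    simp only [chartInv_apply, Subtype.coe_mk] at h1 h2
    simp only [Function.comp_apply]
    rw [h1, h2, MetricCoord.apply_sharpAt_comm (hGm.isInvertible z hz) (hGm.symm z hz)]
  have hIL : g.innerDual x (mvfderiv I u x : TangentSpace I x →ₗ[ℝ] ℝ)
      (mvfderiv I (fun y ↦ g.dalembertian u y
        - g.innerDual y (mvfderiv I V y : TangentSpace I y →ₗ[ℝ] ℝ)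
            (mvfderiv I u y : TangentSpace I y →ₗ[ℝ] ℝ)) x : TangentSpace I x →ₗ[ℝ] ℝ) =
      fderiv ℝ (MetricCoord.lapAt G uh) (extChartAt I x x)
          (MetricCoord.sharpAt G (extChartAt I x x) (fderiv ℝ uh (extChartAt I x x)))
        - fderiv ℝ (fun y ↦ fderiv ℝ uh y (MetricCoord.sharpAt G y (fderiv ℝ Vh y)))
          (extChartAt I x x)
          (MetricCoord.sharpAt G (extChartAt I x x) (fderiv ℝ uh (extChartAt I x x))) := by
    have h := innerDual_chartInv_eq g x u₀ (hud _) (hLd _)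
    rw [hΦu₀] at h
    rw [h, MetricCoord.apply_sharpAt_comm (hGm.isInvertible _ hu0) (hGm.symm _ hu0),
      hLrep.fderiv_eq]
    have hΔd : DifferentiableAt ℝ (MetricCoord.lapAt G uh) (extChartAt I x x) :=
      ((hGm.contDiffOn_lapAt huh _ hu0).contDiffAt
        ((isOpen_extChartAt_target x).mem_nhds hu0)).differentiableAt (by simp)
    have hId : DifferentiableAt ℝ (fun y ↦ fderiv ℝ uh y (MetricCoord.sharpAt G y (fderiv ℝ Vh y)))
        (extChartAt I x x) := hGm.differentiableAt_innerGrad hu0 huh hVh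
    rw [fderiv_fun_sub hΔd hId]
    rfl
  -- (d) the curvature term and `|Hess u|² ≥ 0`
  have hu2 : ContMDiffAt I 𝓘(ℝ, ℝ) 2 u (chartInv I x u₀) :=
    (hu.of_le (WithTop.coe_le_coe.mpr le_top)).contMDiffAt
  have hV2 : ContMDiffAt I 𝓘(ℝ, ℝ) 2 V (chartInv I x u₀) :=
    (hV.of_le (WithTop.coe_le_coe.mpr le_top)).contMDiffAt
  have hN : 0 ≤ MetricCoord.normSqAt G (extChartAt I x x) (MetricCoord.hessAt G uh (extChartAt I x x)) :=
    normSqAt_hessAt_chartRep_nonneg g hR x u₀ hu2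
  have hB := bakryEmery_chartInv_le g x u₀ hV2 (fun X ↦ hRic _ X)
    (MetricCoord.sharpAt G (extChartAt I x x) (fderiv ℝ uh (extChartAt I x x)))
  have hGX : G (extChartAt I x x)
      (MetricCoord.sharpAt G (extChartAt I x x) (fderiv ℝ uh (extChartAt I x x)))
      (MetricCoord.sharpAt G (extChartAt I x x) (fderiv ℝ uh (extChartAt I x x))) = g.gradSq u x := by
    rw [MetricCoord.apply_sharpAt_sharpAt (hGm.isInvertible _ hu0), hgrad]
    rfl
  have hB' : K * g.gradSq u x ≤
      MetricCoord.ricAt G (extChartAt I x x)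
          (MetricCoord.sharpAt G (extChartAt I x x) (fderiv ℝ uh (extChartAt I x x)))
          (MetricCoord.sharpAt G (extChartAt I x x) (fderiv ℝ uh (extChartAt I x x)))
        + MetricCoord.hessAt G Vh (extChartAt I x x)
          (MetricCoord.sharpAt G (extChartAt I x x) (fderiv ℝ uh (extChartAt I x x)))
          (MetricCoord.sharpAt G (extChartAt I x x) (fderiv ℝ uh (extChartAt I x x))) := by
    rw [← hGX]
    exact hB
  rw [hlap, hIV, hIL]
  linarith [key, hN, hB']

end Pointwise

/-! ### The integrated inequality `K ∫ |∇u|² dm ≤ ∫ (Lu)² dm` -/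

section Integrated

variable {E : Type*} [NormedAddCommGroup E] [NormedSpace ℝ E] [FiniteDimensional ℝ E]
  {H : Type*} [TopologicalSpace H] {I : ModelWithCorners ℝ E H} [I.Boundaryless]
  {M : Type*} [TopologicalSpace M] [ChartedSpace H M] [IsManifold I ∞ M]
  [CompactSpace M] [T3Space M] [MeasurableSpace M] [BorelSpace M]
  (g : PseudoRiemannianMetric I ∞ E (TangentSpace I : M → Type _)) [g.HasLeviCivita]

/-- **The integrated `Γ₂`-inequality (spectral-gap inequality) of Bakry–Émery on a closed weighted
manifold**: for `g` Riemannian on a closed manifold (any model space), `V` smooth with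
`Ric + Hess V ≥ K g`, `dm = e^{-V} dV_g`, `L = Δ_g − g⁻¹(dV, d·)`, and every smooth `u`,

  `K ∫_M |∇u|² dm ≤ ∫_M (Lu)² dm`.

Proof: integrate `weightedBochner_pointwise_ge` against `dm`; `∫ L|∇u|² dm = 0`
(`integral_weightedLaplacian_eq_zero`) and `∫ g⁻¹(du, d(Lu)) dm = −∫ (Lu)² dm`
(`integral_mul_weightedLaplacian` with `a = Lu`, `b = u`). Under `CD(K, ∞)` this is the bound
`λ₁(−L) ≥ K` on the spectral gap (Bakry–Gentil–Ledoux, Prop. 4.8.3; Lichnerowicz for `V = 0`).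
[cite: CarrilloNi2009, §3 (C(K,∞), p. 8)] -/
theorem integral_sq_weightedLaplacian_ge (hR : g.IsRiemannian) {V : M → ℝ} {K : ℝ}
    (hV : ContMDiff I 𝓘(ℝ, ℝ) ∞ V)
    (hRic : ∀ (y : M) (X : TangentSpace I y), K * g.val y X X ≤ g.ricci y X X + g.hessian V y X X)
    {u : M → ℝ} (hu : ContMDiff I 𝓘(ℝ, ℝ) ∞ u) :
    K * ∫ x, g.gradSq u x * Real.exp (-V x) ∂g.riemVolume ≤
      ∫ x, (g.dalembertian u x
        - g.innerDual x (mvfderiv I V x : TangentSpace I x →ₗ[ℝ] ℝ)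
            (mvfderiv I u x : TangentSpace I x →ₗ[ℝ] ℝ)) ^ 2 * Real.exp (-V x) ∂g.riemVolume := by
  have hpt := weightedBochner_pointwise_ge g hR hV hRic hu
  -- regularity
  have hu1 : ContMDiff I 𝓘(ℝ, ℝ) 1 u := hu.of_le (by norm_num)
  have hu2 : ContMDiff I 𝓘(ℝ, ℝ) 2 u := hu.of_le (WithTop.coe_le_coe.mpr le_top)
  have hV1 : ContMDiff I 𝓘(ℝ, ℝ) 1 V := hV.of_le (by norm_num)
  have hQ : ContMDiff I 𝓘(ℝ, ℝ) ∞ (g.gradSq u) := contMDiff_gradSq g hu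
  have hQ1 : ContMDiff I 𝓘(ℝ, ℝ) 1 (g.gradSq u) := hQ.of_le (by norm_num)
  have hQ2 : ContMDiff I 𝓘(ℝ, ℝ) 2 (g.gradSq u) := hQ.of_le (WithTop.coe_le_coe.mpr le_top)
  have hLs : ContMDiff I 𝓘(ℝ, ℝ) ∞ (fun y ↦ g.dalembertian u y
      - g.innerDual y (mvfderiv I V y : TangentSpace I y →ₗ[ℝ] ℝ)
          (mvfderiv I u y : TangentSpace I y →ₗ[ℝ] ℝ)) :=
    (contMDiff_dalembertian g hu).sub (contMDiff_innerDual g hV hu)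
  have hL1 : ContMDiff I 𝓘(ℝ, ℝ) 1 (fun y ↦ g.dalembertian u y
      - g.innerDual y (mvfderiv I V y : TangentSpace I y →ₗ[ℝ] ℝ)
          (mvfderiv I u y : TangentSpace I y →ₗ[ℝ] ℝ)) := hLs.of_le (by norm_num)
  -- continuity of the integrands
  have hWc : Continuous fun x ↦ Real.exp (-V x) := Real.continuous_exp.comp hV.continuous.neg
  have hQc : Continuous (g.gradSq u) := hQ.continuous
  have hLc : Continuous (fun y ↦ g.dalembertian u y
      - g.innerDual y (mvfderiv I V y : TangentSpace I y →ₗ[ℝ] ℝ)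
          (mvfderiv I u y : TangentSpace I y →ₗ[ℝ] ℝ)) := hLs.continuous
  have hΔQc : Continuous (g.dalembertian (g.gradSq u)) := continuous_dalembertian g hQ2
  have hIVQ : Continuous fun y ↦ g.innerDual y (mvfderiv I V y : TangentSpace I y →ₗ[ℝ] ℝ)
      (mvfderiv I (g.gradSq u) y : TangentSpace I y →ₗ[ℝ] ℝ) :=
    continuous_innerDual_mvfderiv g hV1 hQ1
  have hIuL : Continuous fun y ↦ g.innerDual y (mvfderiv I u y : TangentSpace I y →ₗ[ℝ] ℝ)
      (mvfderiv I (fun y ↦ g.dalembertian u y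
        - g.innerDual y (mvfderiv I V y : TangentSpace I y →ₗ[ℝ] ℝ)
            (mvfderiv I u y : TangentSpace I y →ₗ[ℝ] ℝ)) y : TangentSpace I y →ₗ[ℝ] ℝ) :=
    continuous_innerDual_mvfderiv g hu1 hL1
  have hILu : Continuous fun y ↦ g.innerDual y
      (mvfderiv I (fun y ↦ g.dalembertian u y
        - g.innerDual y (mvfderiv I V y : TangentSpace I y →ₗ[ℝ] ℝ)
            (mvfderiv I u y : TangentSpace I y →ₗ[ℝ] ℝ)) y : TangentSpace I y →ₗ[ℝ] ℝ)
      (mvfderiv I u y : TangentSpace I y →ₗ[ℝ] ℝ) :=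
    continuous_innerDual_mvfderiv g hL1 hu1
  -- integrability
  have iQ : Integrable (fun x ↦ g.gradSq u x * Real.exp (-V x)) g.riemVolume :=
    g.integrable_of_continuous (hQc.mul hWc)
  have iLQ : Integrable (fun x ↦ (g.dalembertian (g.gradSq u) x
      - g.innerDual x (mvfderiv I V x : TangentSpace I x →ₗ[ℝ] ℝ)
          (mvfderiv I (g.gradSq u) x : TangentSpace I x →ₗ[ℝ] ℝ)) * Real.exp (-V x)) g.riemVolume :=
    g.integrable_of_continuous ((hΔQc.sub hIVQ).mul hWc)
  have iIuL : Integrable (fun x ↦ g.innerDual x (mvfderiv I u x : TangentSpace I x →ₗ[ℝ] ℝ)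
      (mvfderiv I (fun y ↦ g.dalembertian u y
        - g.innerDual y (mvfderiv I V y : TangentSpace I y →ₗ[ℝ] ℝ)
            (mvfderiv I u y : TangentSpace I y →ₗ[ℝ] ℝ)) x : TangentSpace I x →ₗ[ℝ] ℝ)
      * Real.exp (-V x)) g.riemVolume := g.integrable_of_continuous (hIuL.mul hWc)
  have iB : Integrable (fun x ↦ ((1 / 2) * (g.dalembertian (g.gradSq u) x
        - g.innerDual x (mvfderiv I V x : TangentSpace I x →ₗ[ℝ] ℝ)
            (mvfderiv I (g.gradSq u) x : TangentSpace I x →ₗ[ℝ] ℝ))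
      - g.innerDual x (mvfderiv I u x : TangentSpace I x →ₗ[ℝ] ℝ)
          (mvfderiv I (fun y ↦ g.dalembertian u y
            - g.innerDual y (mvfderiv I V y : TangentSpace I y →ₗ[ℝ] ℝ)
                (mvfderiv I u y : TangentSpace I y →ₗ[ℝ] ℝ)) x : TangentSpace I x →ₗ[ℝ] ℝ))
      * Real.exp (-V x)) g.riemVolume :=
    g.integrable_of_continuous (((continuous_const.mul (hΔQc.sub hIVQ)).sub hIuL).mul hWc)
  -- integrate the pointwise inequality
  have hmono : ∫ x, K * g.gradSq u x * Real.exp (-V x) ∂g.riemVolume ≤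
      ∫ x, ((1 / 2) * (g.dalembertian (g.gradSq u) x
        - g.innerDual x (mvfderiv I V x : TangentSpace I x →ₗ[ℝ] ℝ)
            (mvfderiv I (g.gradSq u) x : TangentSpace I x →ₗ[ℝ] ℝ))
      - g.innerDual x (mvfderiv I u x : TangentSpace I x →ₗ[ℝ] ℝ)
          (mvfderiv I (fun y ↦ g.dalembertian u y
            - g.innerDual y (mvfderiv I V y : TangentSpace I y →ₗ[ℝ] ℝ)
                (mvfderiv I u y : TangentSpace I y →ₗ[ℝ] ℝ)) x : TangentSpace I x →ₗ[ℝ] ℝ))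
      * Real.exp (-V x) ∂g.riemVolume :=
    integral_mono (iQ.const_mul K |>.congr (Eventually.of_forall fun x ↦ by ring)) iB fun x ↦
      mul_le_mul_of_nonneg_right (hpt x) (Real.exp_pos _).le
  -- the named integrals
  have s0 : ∫ x, K * g.gradSq u x * Real.exp (-V x) ∂g.riemVolume =
      K * ∫ x, g.gradSq u x * Real.exp (-V x) ∂g.riemVolume := by
    rw [← integral_const_mul]
    exact integral_congr_ae (Eventually.of_forall fun x ↦ by ring)
  have s1 : ∫ x, ((1 / 2) * (g.dalembertian (g.gradSq u) x
        - g.innerDual x (mvfderiv I V x : TangentSpace I x →ₗ[ℝ] ℝ)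
            (mvfderiv I (g.gradSq u) x : TangentSpace I x →ₗ[ℝ] ℝ))
      - g.innerDual x (mvfderiv I u x : TangentSpace I x →ₗ[ℝ] ℝ)
          (mvfderiv I (fun y ↦ g.dalembertian u y
            - g.innerDual y (mvfderiv I V y : TangentSpace I y →ₗ[ℝ] ℝ)
                (mvfderiv I u y : TangentSpace I y →ₗ[ℝ] ℝ)) x : TangentSpace I x →ₗ[ℝ] ℝ))
      * Real.exp (-V x) ∂g.riemVolume =
      ∫ x, ((1 / 2) * ((g.dalembertian (g.gradSq u) x
        - g.innerDual x (mvfderiv I V x : TangentSpace I x →ₗ[ℝ] ℝ)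
            (mvfderiv I (g.gradSq u) x : TangentSpace I x →ₗ[ℝ] ℝ)) * Real.exp (-V x))
        - g.innerDual x (mvfderiv I u x : TangentSpace I x →ₗ[ℝ] ℝ)
          (mvfderiv I (fun y ↦ g.dalembertian u y
            - g.innerDual y (mvfderiv I V y : TangentSpace I y →ₗ[ℝ] ℝ)
                (mvfderiv I u y : TangentSpace I y →ₗ[ℝ] ℝ)) x : TangentSpace I x →ₗ[ℝ] ℝ)
          * Real.exp (-V x)) ∂g.riemVolume :=
    integral_congr_ae (Eventually.of_forall fun x ↦ by ring)
  have s2 : ∫ x, ((1 / 2) * ((g.dalembertian (g.gradSq u) x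
        - g.innerDual x (mvfderiv I V x : TangentSpace I x →ₗ[ℝ] ℝ)
            (mvfderiv I (g.gradSq u) x : TangentSpace I x →ₗ[ℝ] ℝ)) * Real.exp (-V x))
        - g.innerDual x (mvfderiv I u x : TangentSpace I x →ₗ[ℝ] ℝ)
          (mvfderiv I (fun y ↦ g.dalembertian u y
            - g.innerDual y (mvfderiv I V y : TangentSpace I y →ₗ[ℝ] ℝ)
                (mvfderiv I u y : TangentSpace I y →ₗ[ℝ] ℝ)) x : TangentSpace I x →ₗ[ℝ] ℝ)
          * Real.exp (-V x)) ∂g.riemVolume =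
      ∫ x, (1 / 2) * ((g.dalembertian (g.gradSq u) x
        - g.innerDual x (mvfderiv I V x : TangentSpace I x →ₗ[ℝ] ℝ)
            (mvfderiv I (g.gradSq u) x : TangentSpace I x →ₗ[ℝ] ℝ)) * Real.exp (-V x)) ∂g.riemVolume
      - ∫ x, g.innerDual x (mvfderiv I u x : TangentSpace I x →ₗ[ℝ] ℝ)
          (mvfderiv I (fun y ↦ g.dalembertian u y
            - g.innerDual y (mvfderiv I V y : TangentSpace I y →ₗ[ℝ] ℝ)
                (mvfderiv I u y : TangentSpace I y →ₗ[ℝ] ℝ)) x : TangentSpace I x →ₗ[ℝ] ℝ)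
          * Real.exp (-V x) ∂g.riemVolume := integral_sub (iLQ.const_mul _) iIuL
  have s3 : ∫ x, (1 / 2) * ((g.dalembertian (g.gradSq u) x
        - g.innerDual x (mvfderiv I V x : TangentSpace I x →ₗ[ℝ] ℝ)
            (mvfderiv I (g.gradSq u) x : TangentSpace I x →ₗ[ℝ] ℝ)) * Real.exp (-V x)) ∂g.riemVolume =
      (1 / 2) * ∫ x, (g.dalembertian (g.gradSq u) x
        - g.innerDual x (mvfderiv I V x : TangentSpace I x →ₗ[ℝ] ℝ)
            (mvfderiv I (g.gradSq u) x : TangentSpace I x →ₗ[ℝ] ℝ)) * Real.exp (-V x) ∂g.riemVolume :=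
    integral_const_mul _ _
  -- Green: `∫ L|∇u|² dm = 0`
  have s4 : ∫ x, (g.dalembertian (g.gradSq u) x
        - g.innerDual x (mvfderiv I V x : TangentSpace I x →ₗ[ℝ] ℝ)
            (mvfderiv I (g.gradSq u) x : TangentSpace I x →ₗ[ℝ] ℝ)) * Real.exp (-V x) ∂g.riemVolume = 0 :=
    integral_weightedLaplacian_eq_zero g hR hQ2 hV1
  -- Green: `∫ (Lu)(Lu) dm = −∫ g⁻¹(d(Lu), du) dm`
  have s5 := integral_mul_weightedLaplacian g hR hL1 hu2 hV1
  have s6 : ∫ x, g.innerDual x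
      (mvfderiv I (fun y ↦ g.dalembertian u y
        - g.innerDual y (mvfderiv I V y : TangentSpace I y →ₗ[ℝ] ℝ)
            (mvfderiv I u y : TangentSpace I y →ₗ[ℝ] ℝ)) x : TangentSpace I x →ₗ[ℝ] ℝ)
      (mvfderiv I u x : TangentSpace I x →ₗ[ℝ] ℝ) * Real.exp (-V x) ∂g.riemVolume =
      ∫ x, g.innerDual x (mvfderiv I u x : TangentSpace I x →ₗ[ℝ] ℝ)
        (mvfderiv I (fun y ↦ g.dalembertian u y
          - g.innerDual y (mvfderiv I V y : TangentSpace I y →ₗ[ℝ] ℝ)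
              (mvfderiv I u y : TangentSpace I y →ₗ[ℝ] ℝ)) x : TangentSpace I x →ₗ[ℝ] ℝ)
        * Real.exp (-V x) ∂g.riemVolume :=
    integral_congr_ae (Eventually.of_forall fun x ↦ by dsimp only; rw [g.innerDual_comm])
  have s7 : ∫ x, (g.dalembertian u x
        - g.innerDual x (mvfderiv I V x : TangentSpace I x →ₗ[ℝ] ℝ)
            (mvfderiv I u x : TangentSpace I x →ₗ[ℝ] ℝ)) *
        (g.dalembertian u x
        - g.innerDual x (mvfderiv I V x : TangentSpace I x →ₗ[ℝ] ℝ)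
            (mvfderiv I u x : TangentSpace I x →ₗ[ℝ] ℝ)) * Real.exp (-V x) ∂g.riemVolume =
      ∫ x, (g.dalembertian u x
        - g.innerDual x (mvfderiv I V x : TangentSpace I x →ₗ[ℝ] ℝ)
            (mvfderiv I u x : TangentSpace I x →ₗ[ℝ] ℝ)) ^ 2 * Real.exp (-V x) ∂g.riemVolume :=
    integral_congr_ae (Eventually.of_forall fun x ↦ by ring)
  linarith [hmono, s0, s1, s2, s3, s4, s5, s6, s7]

end Integrated

end Literature.Geometry.Riemannian

end
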